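import Summits.QuantumAdvantage.QuantumAdvantage.Theorems.CubicForrelationNearExactIsExactTwelveZ768Div4Dead
import Summits.QuantumAdvantage.QuantumAdvantage.Theorems.CubicForrelationNearExactIsExactTwelveLevelSixGammaSmall
import Summits.QuantumAdvantage.QuantumAdvantage.Theorems.CubicForrelationNearExactIsExactTwelveLevelSixPrep

/-!
# Crux `CubicForrelation.NearExactIsExact` (stmt-QuantumAdvantage-14043) — n = 12, the OPEN window `57/64 < Φ < 29/32`, both sides at
  level `≥ 6`, configuration `#Z = 512` (the even set is a 9-flat): the MAIN BRANCH "`8 ∣ e` off `Z` and `e ≡ ±1 (mod 8)` on `Z`" is DEAD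
  on the whole window

Certificate seat `b2b-cforr-cert` (gen 26).  HONEST FRAMING: a kernel-checked finite-slice lemma (standard axioms) about cubic Boolean pairs on 12
bits; it closes ONE sub-configuration of the level-`≥ 6` × level-`≥ 6` branch below `29/32` for ALL sixteen undecided values at once and claims
NO new value of `θ₁₂` (`θ₁₂ ∈ [57/64, 14847/16384]` unchanged).  NOT summit progress.

Setting.  Cubic `f, g` on 12 bits, `W_g = 64u''`, `W_f = 64wf`, `e := u'' − (−1)^f`, `Z := {u'' even} = x_Z ⊕ V₀` a 9-flat (by gen 26's
`tzw_levelSix_window_Z512` this is the only level-`≥ 6` configuration left on the window), `57/64 < Φ < 1`, so `B := Σ e² = 8192(1 − Φ) ≤ 895`.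
HYPOTHESIS of this file: the perturbation `π := e − σ·1_Z` (`σ := e mod 4` on `Z`) is `≡ 0 (mod 8)` EVERYWHERE, i.e. `8 ∣ e` off `Z` and
`e ≡ ±1 (mod 8)` on `Z` (no point of `Z` with `|e| ∈ {3, 5, 11, …}`: the set `L` of gens 20–23 is empty) — the "main branch" of the off-flat
trichotomy (`tw20_off_flat_lt256`) combined with the ℓ¹-engine regime `#L ≤ 31 ⇒ L = ∅`.

THEOREM `tzf_Z512_div8_false`: impossible.  Proof (the (γ)-small argument of gen 23 run on the signed indicator, with a perturbation budget).
`S := σ·1_Z` has parametrised 6-flat sums `≡ 0 (mod 4)` and 7-flat sums `≡ 0 (mod 8)` (those of `e`, `gh_flat_dvd`, minus those of `π ∈ 8ℤ`),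
and vanishes off `Z`; three transversal directions (`ep_dirs3`) localise them (`ep_loc3`) to (H3) `4 ∣ Σ_{3-flat ⊂ Z} σ` and (H4)
`8 ∣ Σ_{4-flat ⊂ Z} σ`.  Then gen 15/23's radical machine: `fr_hsd`, `fr_radical_large` (`#R ≥ 128`), `sw_card_xorClosed` (`#R = 2^k`),
`d0_Shat_sq` + `gs_SR` (`M(y)² ∈ {0, 512·2^k}`), `ktg_sq_eq_two_pow` ⇒ the integer character sum `M(y) = Ŝ(y)` is `≡ 0 (mod 256)` for every
`y`.  The perturbation is small: pointwise `24|π| ≤ 4e² − 4·1_Z` (`e = σ + 8μ` on `Z`: `192|μ| ≤ 64σμ + 256μ²`; off `Z`: `24|π| ≤ 3π²`), so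
`24·Σ|π| ≤ 4B − 2048 ≤ 1532`, `Σ|π| ≤ 63`.  The partner is not bent (`tw_bent_end`), so some `wf(y₀)` is even, `e′(y₀)` is odd, and the duality
`ê(y₀) = −64e′(y₀)` (`l5k_duality`) gives `π̂(y₀) = −64e′(y₀) − 256m = 64·(e′ + 4m)` with `e′ + 4m` odd: `|π̂(y₀)| ≥ 64 > 63`.  Contradiction.

Packaging of the residual configuration: …TwelveZ512WindowResidual (`tzf_levelSix_window_residual`, `_L`, `_2`).
What is left of `#Z = 512` on the window (successor work): a point off `Z` with `8 ∤ e` (off-flat energy `E_off = B − 512 − Σ_Z(e² − 1)`;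
for `E_off < 256` the trichotomy's sparse / rigid exceptions, for `E_off ≥ 256` new territory), or `L ≠ ∅` (then `#L = 32`, a 5-flat of
points with `|e| = 3`, `Σ_Z(e² − 1) ≥ 256`, `E_off ≤ 124`).

References: MacWilliams–Sloane (1977) Ch. 13 §3, Ch. 15; R. O'Donnell (2014) §1.4, §3.3; D. Simon (1994) §3.1.  Axioms: the standard three.
-/

set_option linter.dupNamespace false -- D-0017: single-problem summit ⇒ `QuantumAdvantage.QuantumAdvantage` by design

noncomputable section

namespace Summit.QuantumAdvantage.QuantumAdvantage.Theorems.CubicForrelation.NearExactIsExact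

open Finset
open Literature.Computability.QuantumComplexity
open Literature.Computability.QuantumComplexity.BuzetChailloux (bxor zeroVec bxor_bxor_cancel_left bxor_zeroVec zeroVec_bxor bxor_comm
  bxor_self)
open Literature.Computability.QuantumComplexity.DerivativeWalsh (W)
open Literature.Computability.QuantumComplexity.Simon (twist_eq_one_or)

/-- `ℓ¹` versus energy on `Z` at modulus `8`: `s = ±1`, `8 ∣ p` ⇒ `24|p| ≤ 4(s + p)² − 4`. [folklore] -/
theorem tzf_l1_onZ {s p : ℤ} (hs : s = 1 ∨ s = -1) (hp : (8 : ℤ) ∣ p) : 24 * |p| ≤ 4 * (s + p) ^ 2 - 4 := by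
  obtain ⟨q, rfl⟩ := hp
  rcases le_or_gt 0 q with hq | hq
  · rw [abs_of_nonneg (by linarith)]
    rcases eq_or_lt_of_le hq with h | h
    · subst h; rcases hs with rfl | rfl <;> norm_num
    · have h1 : (1 : ℤ) ≤ q := h
      rcases hs with rfl | rfl <;> nlinarith
  · rw [abs_of_neg (by linarith)]
    have h1 : q ≤ -1 := by omega
    rcases hs with rfl | rfl <;> nlinarith

/-- `ℓ¹` versus energy off `Z` at modulus `8`: `8 ∣ p` ⇒ `24|p| ≤ 4p²`. [folklore] -/
theorem tzf_l1_offZ {p : ℤ} (hp : (8 : ℤ) ∣ p) : 24 * |p| ≤ 4 * p ^ 2 := by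
  obtain ⟨q, rfl⟩ := hp
  rcases le_or_gt 0 q with hq | hq
  · rw [abs_of_nonneg (by linarith)]
    rcases eq_or_lt_of_le hq with h | h
    · subst h; norm_num
    · have h1 : (1 : ℤ) ≤ q := h
      nlinarith
  · rw [abs_of_neg (by linarith)]
    have h1 : q ≤ -1 := by omega
    nlinarith

/-- **The main branch of `#Z = 512` is dead on the open window** (both sides at level `≥ 6`; module docstring): cubic `f, g` on 12 bits,
`W_g = 64u''`, `W_f = 64wf`, `Z = {u'' even} = x_Z ⊕ V₀` a 9-flat, `8 ∣ u'' − (−1)^f` off `Z`, `u'' − (−1)^f ≡ ±1 (mod 8)` on `Z`,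
`57/64 < Φ(f,g) < 1` ⇒ `False`.  Finite-slice statement, NOT summit progress. [this work] -/
theorem tzf_Z512_div8_false (f g : (Fin (6 + 6) → Bool) → Bool) (hf : IsDegLeFun 3 f) (hg : IsDegLeFun 3 g)
    (u'' : (Fin (6 + 6) → Bool) → ℤ) (hu'' : ∀ x, W (fun y => signOf (g y)) x = (2 : ℝ) ^ 6 * (u'' x : ℝ))
    (wf : (Fin (6 + 6) → Bool) → ℤ) (hwf : ∀ y, W (fun x => signOf (f x)) y = (2 : ℝ) ^ 6 * (wf y : ℝ))
    (V₀ : Finset (Fin (6 + 6) → Bool)) (xZ : Fin (6 + 6) → Bool) (h0 : zeroVec ∈ V₀)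
    (hadd : ∀ a ∈ V₀, ∀ b ∈ V₀, bxor a b ∈ V₀) (hcardV : #V₀ = 512)
    (hS : (univ.filter fun x : Fin (6 + 6) → Bool => ¬ Odd (u'' x)) = V₀.image (bxor xZ))
    (h8off : ∀ y, y ∉ (univ.filter fun x : Fin (6 + 6) → Bool => ¬ Odd (u'' x)) → (8 : ℤ) ∣ u'' y - sZ (f y))
    (h8on : ∀ x ∈ (univ.filter fun x : Fin (6 + 6) → Bool => ¬ Odd (u'' x)),
      (8 : ℤ) ∣ u'' x - sZ (f x) - 1 ∨ (8 : ℤ) ∣ u'' x - sZ (f x) + 1)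
    (hlo : (57 / 64 : ℝ) < forrelation f g) (hhi : forrelation f g < 1) : False := by
  classical
  set Z := univ.filter (fun x : Fin (6 + 6) → Bool => ¬ Odd (u'' x)) with hZdef
  have hmemZ : ∀ x, x ∈ Z ↔ ¬ Odd (u'' x) := fun x => by simp [hZdef]
  set e : (Fin (6 + 6) → Bool) → ℤ := fun x => u'' x - sZ (f x) with hedef
  have h8off' : ∀ y, y ∉ Z → (8 : ℤ) ∣ e y := h8off
  have h8on' : ∀ x ∈ Z, (8 : ℤ) ∣ e x - 1 ∨ (8 : ℤ) ∣ e x + 1 := h8on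
  have hxZ : xZ ∈ Z := by rw [hS]; exact mem_image.2 ⟨zeroVec, h0, bxor_zeroVec xZ⟩
  have hPV : ∀ x, x ∈ Z → ∀ a ∈ V₀, bxor x a ∈ Z := fun x hx a ha => fl1_coset_vadd hadd hS hx ha
  have hVP : ∀ x, x ∈ Z → bxor xZ x ∈ V₀ := fun x hx => fl1_coset_diff hS hx
  -- the budget `B = Σ e² = 8192(1 − Φ) ≤ 895`
  set u : (Fin (6 + 6) → Bool) → ℤ := fun x => 4 * u'' x with hudef
  have hu : ∀ x, W (fun y => signOf (g y)) x = (2 : ℝ) ^ 4 * (u x : ℝ) := by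
    intro x; rw [hu'' x]; simp only [u]; push_cast; ring
  have hbud := tw12_budget f g u hu
  have h16 : ∀ x, (u x - 4 * sZ (f x)) ^ 2 = 16 * e x ^ 2 := fun x => by simp only [u, e]; ring
  have hBR : ((∑ x, e x ^ 2 : ℤ) : ℝ) = 8192 * (1 - forrelation f g) := by
    have h' : ((∑ x, (u x - 4 * sZ (f x)) ^ 2 : ℤ) : ℝ) = 16 * ((∑ x, e x ^ 2 : ℤ) : ℝ) := by
      rw [sum_congr rfl fun x _ => h16 x, ← mul_sum]; push_cast; ring
    rw [h'] at hbud
    linarith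
  have hB : (∑ x, e x ^ 2 : ℤ) ≤ 895 := by
    have h' : ((∑ x, e x ^ 2 : ℤ) : ℝ) < 896 := by rw [hBR]; linarith
    have h'' : (∑ x, e x ^ 2 : ℤ) < 896 := by exact_mod_cast h'
    omega
  -- the sign `σ = e mod 8` on `Z` (a Boolean `hb`) and the signed indicator `S = σ·1_Z`
  obtain ⟨hb, hbdef⟩ : ∃ hb : (Fin (6 + 6) → Bool) → Bool, hb = fun x => decide ((8 : ℤ) ∣ e x + 1) := ⟨_, rfl⟩
  obtain ⟨S, hSdef⟩ : ∃ S : (Fin (6 + 6) → Bool) → ℤ, S = fun x => if x ∈ Z then sZ (hb x) else 0 := ⟨_, rfl⟩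
  have hSZ : ∀ x ∈ Z, S x = sZ (hb x) := fun x hx => by rw [hSdef]; simp [hx]
  have hS0 : ∀ y, y ∉ Z → S y = 0 := fun y hy => by rw [hSdef]; simp [hy]
  -- the perturbation `π = e − S ∈ 8ℤ`
  have hπ8 : ∀ x, (8 : ℤ) ∣ e x - S x := by
    intro x
    by_cases hx : x ∈ Z
    · by_cases h1 : (8 : ℤ) ∣ e x + 1
      · have hbx : hb x = true := by rw [hbdef]; exact decide_eq_true h1
        have hsT : sZ true = -1 := by simp [sZ]
        rw [hSZ x hx, hbx, hsT, sub_neg_eq_add]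
        exact h1
      · have hbx : hb x = false := by rw [hbdef]; exact decide_eq_false h1
        have hsF : sZ false = 1 := by simp [sZ]
        rw [hSZ x hx, hbx, hsF]
        rcases h8on' x hx with h | h
        · exact h
        · exact absurd h h1
    · rw [hS0 x hx, sub_zero]; exact h8off' x hx
  -- flat sums of `S`: 6-flats `≡ 0 (mod 4)`, 7-flats `≡ 0 (mod 8)`
  have hS6 : ∀ (b : Fin (6 + 6) → Bool) (a : Fin 6 → Fin (6 + 6) → Bool),
      (4 : ℤ) ∣ ∑ ε : Fin 6 → Bool, S (fun j => b j ^^ decide (Odd #(univ.filter fun i => ε i && a i j))) := by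
    intro b a
    have h := gh_flat_dvd (e := 2) f g hf hg u'' hu'' b a (by norm_num) (by norm_num)
    rw [show ((2 : ℤ) ^ 2) = 4 by norm_num] at h
    have hsplit : ∑ ε : Fin 6 → Bool, S (fun j => b j ^^ decide (Odd #(univ.filter fun i => ε i && a i j))) =
        ∑ ε : Fin 6 → Bool, e (fun j => b j ^^ decide (Odd #(univ.filter fun i => ε i && a i j))) -
        ∑ ε : Fin 6 → Bool, (e (fun j => b j ^^ decide (Odd #(univ.filter fun i => ε i && a i j))) -
          S (fun j => b j ^^ decide (Odd #(univ.filter fun i => ε i && a i j)))) := by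
      rw [← sum_sub_distrib]; exact sum_congr rfl fun ε _ => by ring
    rw [hsplit]
    exact dvd_sub h (dvd_sum fun ε _ => (show (4 : ℤ) ∣ 8 from ⟨2, by norm_num⟩).trans (hπ8 _))
  have hS7 : ∀ (b : Fin (6 + 6) → Bool) (a : Fin 7 → Fin (6 + 6) → Bool),
      (8 : ℤ) ∣ ∑ ε : Fin 7 → Bool, S (fun j => b j ^^ decide (Odd #(univ.filter fun i => ε i && a i j))) := by
    intro b a
    have h := gh_flat_dvd (e := 3) f g hf hg u'' hu'' b a (by norm_num) (by norm_num)
    rw [show ((2 : ℤ) ^ 3) = 8 by norm_num] at h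
    have hsplit : ∑ ε : Fin 7 → Bool, S (fun j => b j ^^ decide (Odd #(univ.filter fun i => ε i && a i j))) =
        ∑ ε : Fin 7 → Bool, e (fun j => b j ^^ decide (Odd #(univ.filter fun i => ε i && a i j))) -
        ∑ ε : Fin 7 → Bool, (e (fun j => b j ^^ decide (Odd #(univ.filter fun i => ε i && a i j))) -
          S (fun j => b j ^^ decide (Odd #(univ.filter fun i => ε i && a i j)))) := by
      rw [← sum_sub_distrib]; exact sum_congr rfl fun ε _ => by ring
    rw [hsplit]
    exact dvd_sub h (dvd_sum fun ε _ => hπ8 _)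
  -- localisation: (H3)/(H4) for the sign on `Z`
  obtain ⟨t₁, -, t₂, -, t₃, -, n1, n2, n21, n3, n31, n32, n321⟩ := ep_dirs3 univ V₀ (by
    rw [hcardV, card_univ, Fintype.card_fun, Fintype.card_bool, Fintype.card_fin]; norm_num)
  have hz : ∀ p ∈ Z, ∀ w, w ∉ V₀ → S (bxor p w) = 0 := fun p hp w hw => hS0 _ (fl1_coset_out h0 hadd hS hp hw)
  have hloc : ∀ {k : ℕ} (x : Fin (6 + 6) → Bool) (a : Fin k → Fin (6 + 6) → Bool),
      (∀ ε : Fin k → Bool, (fun j => x j ^^ decide (Odd #(univ.filter fun i => ε i && a i j))) ∈ Z) →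
      ∑ ε : Fin (k + 3) → Bool, S (fun j => x j ^^ decide (Odd #(univ.filter fun i =>
          ε i && (Matrix.vecCons t₁ (Matrix.vecCons t₂ (Matrix.vecCons t₃ a)) : Fin (k + 3) → Fin (6 + 6) → Bool) i j))) =
      ∑ ε : Fin k → Bool, S (fun j => x j ^^ decide (Odd #(univ.filter fun i => ε i && a i j))) := by
    intro k x a hin
    exact ep_loc3 S x t₁ t₂ t₃ a
      (fun ε => hz _ (hin ε) t₁ n1) (fun ε => hz _ (hin ε) t₂ n2)
      (fun ε => by rw [iw_bxor_assoc]; exact hz _ (hin ε) _ n21)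
      (fun ε => hz _ (hin ε) t₃ n3)
      (fun ε => by rw [iw_bxor_assoc]; exact hz _ (hin ε) _ n31)
      (fun ε => by rw [iw_bxor_assoc]; exact hz _ (hin ε) _ n32)
      (fun ε => by rw [iw_bxor_assoc, iw_bxor_assoc]; exact hz _ (hin ε) _ n321)
  have H3σ : ∀ x, x ∈ Z → ∀ a b c : Fin (6 + 6) → Bool, a ∈ V₀ → b ∈ V₀ → c ∈ V₀ →
      (4 : ℤ) ∣ ∑ ε : Fin 3 → Bool, sZ (hb (fun j => x j ^^ decide (Odd #(univ.filter fun i =>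
        ε i && (![a, b, c] : Fin 3 → Fin (6 + 6) → Bool) i j)))) := by
    intro x hx a b c ha hb' hc'
    have hin : ∀ ε : Fin 3 → Bool, (fun j => x j ^^ decide (Odd #(univ.filter fun i =>
        ε i && (![a, b, c] : Fin 3 → Fin (6 + 6) → Bool) i j))) ∈ Z :=
      fun ε => fr_mem_flatPt3 V₀ h0 (· ∈ Z) hPV hx ![a, b, c] (fun i => by fin_cases i <;> assumption) ε
    have h := hS6 x ![t₁, t₂, t₃, a, b, c]
    have e6 : (![t₁, t₂, t₃, a, b, c] : Fin 6 → Fin (6 + 6) → Bool) =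
        Matrix.vecCons t₁ (Matrix.vecCons t₂ (Matrix.vecCons t₃ ![a, b, c])) := rfl
    rw [e6, hloc x ![a, b, c] hin, sum_congr rfl fun ε _ => hSZ _ (hin ε)] at h
    exact h
  have H4σ : ∀ x, x ∈ Z → ∀ a₀ a₁ a₂ a₃ : Fin (6 + 6) → Bool, a₀ ∈ V₀ → a₁ ∈ V₀ → a₂ ∈ V₀ → a₃ ∈ V₀ →
      (8 : ℤ) ∣ ∑ ε : Fin 4 → Bool, sZ (hb (fun j => x j ^^ decide (Odd #(univ.filter fun i =>
        ε i && (![a₀, a₁, a₂, a₃] : Fin 4 → Fin (6 + 6) → Bool) i j)))) := by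
    intro x hx a₀ a₁ a₂ a₃ ha₀ ha₁ ha₂ ha₃
    have hin : ∀ ε : Fin 4 → Bool, (fun j => x j ^^ decide (Odd #(univ.filter fun i =>
        ε i && (![a₀, a₁, a₂, a₃] : Fin 4 → Fin (6 + 6) → Bool) i j))) ∈ Z :=
      fun ε => fr_mem_flatPt4 V₀ h0 (· ∈ Z) hPV hx ![a₀, a₁, a₂, a₃] (fun i => by fin_cases i <;> assumption) ε
    have h := hS7 x ![t₁, t₂, t₃, a₀, a₁, a₂, a₃]
    have e7 : (![t₁, t₂, t₃, a₀, a₁, a₂, a₃] : Fin 7 → Fin (6 + 6) → Bool) =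
        Matrix.vecCons t₁ (Matrix.vecCons t₂ (Matrix.vecCons t₃ ![a₀, a₁, a₂, a₃])) := rfl
    rw [e7, hloc x ![a₀, a₁, a₂, a₃] hin, sum_congr rfl fun ε _ => hSZ _ (hin ε)] at h
    exact h
  -- the radical machine: `256 ∣ M(y)` for the integer character sum of the sign on `Z`
  have hsd := fr_hsd V₀ (· ∈ Z) xZ hxZ hVP hb H3σ
  have hRbig := fr_radical_large V₀ (· ∈ Z) xZ hb hadd hxZ hPV hVP H3σ H4σ
  set R := (V₀.filter fun r => ∀ v ∈ V₀, (hb xZ ^^ hb (bxor xZ r) ^^ hb (bxor xZ v) ^^ hb (bxor (bxor xZ r) v)) = false) with hR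
  rw [hcardV] at hRbig
  have hRadd := fr_radical_add V₀ (· ∈ Z) xZ hb hxZ hPV hadd hsd
  have hR0 : zeroVec ∈ R := fr_radical_zero_mem V₀ xZ hb h0
  obtain ⟨k, -, hk⟩ := sw_card_xorClosed R hR0 hRadd
  have hk7 : 7 ≤ k := by
    by_contra hlt
    push Not at hlt
    rw [hk] at hRbig
    interval_cases k <;> norm_num at hRbig
  have hM : ∀ y : Fin (6 + 6) → Bool, ((∑ x ∈ Z, sZ (hb x) * sZ (decide (Odd #(univ.filter fun i => x i && y i))) : ℤ) : ℝ) =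
      ∑ x ∈ Z, signOf (hb x) * twist x y := by
    intro y; push_cast
    exact sum_congr rfl fun x _ => by rw [tp_sZ_cast, tp_sZ_cast, ← vg_twist_eq_signOf]
  have h256 : ∀ y : Fin (6 + 6) → Bool, (256 : ℤ) ∣ ∑ x ∈ Z, sZ (hb x) * sZ (decide (Odd #(univ.filter fun i => x i && y i))) := by
    intro y
    have hSq := d0_Shat_sq V₀ u'' xZ h0 hadd hcardV hS hb hsd y
    rw [← hM y] at hSq
    rcases gs_SR V₀ u'' xZ h0 hadd hS hb hsd y with h | h
    · rw [h, mul_zero] at hSq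
      have : (∑ x ∈ Z, sZ (hb x) * sZ (decide (Odd #(univ.filter fun i => x i && y i))) : ℤ) = 0 := by
        exact_mod_cast (pow_eq_zero_iff two_ne_zero).1 hSq
      rw [this]; exact dvd_zero _
    · set M := (∑ x ∈ Z, sZ (hb x) * sZ (decide (Odd #(univ.filter fun i => x i && y i))) : ℤ) with hMdef
      rw [h, hk] at hSq
      push_cast at hSq
      have hsqZ : M ^ 2 = 2 ^ (9 + k) := by
        have : ((M ^ 2 : ℤ) : ℝ) = ((2 ^ (9 + k) : ℤ) : ℝ) := by
          push_cast; rw [hSq, pow_add]; norm_num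
        exact_mod_cast this
      have hnat : M.natAbs * M.natAbs = 2 ^ (9 + k) := by
        have h1 : ((M.natAbs * M.natAbs : ℕ) : ℤ) = M ^ 2 := by rw [Int.natAbs_mul_self, sq]
        have h2 : ((M.natAbs * M.natAbs : ℕ) : ℤ) = ((2 ^ (9 + k) : ℕ) : ℤ) := by rw [h1, hsqZ]; norm_cast
        exact_mod_cast h2
      obtain ⟨j, hj, hMj⟩ := ktg_sq_eq_two_pow (9 + k) M.natAbs hnat
      have hj8 : 8 ≤ j := by omega
      have hdvd : (2 ^ 8 : ℕ) ∣ M.natAbs := by rw [hMj]; exact pow_dvd_pow 2 hj8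
      have : ((2 ^ 8 : ℕ) : ℤ) ∣ M := Int.natAbs_dvd_natAbs.1 (by simpa using hdvd)
      norm_num at this
      exact this
  -- `Ŝ(y) = M(y)`
  have hShat : ∀ y : Fin (6 + 6) → Bool, ∑ a, ((S a : ℤ) : ℝ) * twist a y =
      ((∑ x ∈ Z, sZ (hb x) * sZ (decide (Odd #(univ.filter fun i => x i && y i))) : ℤ) : ℝ) := by
    intro y
    rw [hM y]
    have hres : ∑ a, ((S a : ℤ) : ℝ) * twist a y = ∑ a ∈ Z, ((S a : ℤ) : ℝ) * twist a y := by
      symm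
      apply sum_subset (subset_univ Z)
      intro x _ hx
      rw [hS0 x hx]; simp
    rw [hres]
    exact sum_congr rfl fun x hx => by rw [hSZ x hx, tp_sZ_cast]
  -- pointwise `ℓ¹` bound: `24|π| ≤ 4e² − 4·1_Z`, hence `24Σ|π| ≤ 4B − 2048 ≤ 1532`
  have hl1Z : ∀ x ∈ Z, 24 * |e x - S x| ≤ 4 * e x ^ 2 - 4 := by
    intro x hx
    have h := tzf_l1_onZ (tp_sZ_cases (hb x)) (hπ8 x)
    rw [hSZ x hx] at h ⊢
    have ee : sZ (hb x) + (e x - sZ (hb x)) = e x := by ring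
    rwa [ee] at h
  have hl1off : ∀ x, x ∉ Z → 24 * |e x - S x| ≤ 4 * e x ^ 2 := by
    intro x hx
    have h := tzf_l1_offZ (hπ8 x)
    rw [hS0 x hx, sub_zero] at h ⊢
    exact h
  have hl1 : 24 * ∑ x, |e x - S x| ≤ 1532 := by
    have hpt : ∀ x, 24 * |e x - S x| ≤ 4 * e x ^ 2 - (if x ∈ Z then 4 else 0) := by
      intro x
      by_cases hx : x ∈ Z
      · rw [if_pos hx]; exact hl1Z x hx
      · rw [if_neg hx, sub_zero]; exact hl1off x hx
    have hsum : 24 * ∑ x, |e x - S x| ≤ ∑ x, (4 * e x ^ 2 - (if x ∈ Z then 4 else 0) : ℤ) := by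
      rw [mul_sum]; exact sum_le_sum fun x _ => hpt x
    have hind : ∑ x, (if x ∈ Z then (4 : ℤ) else 0) = 2048 := by
      rw [← sum_filter, sum_const, nsmul_eq_mul]
      have : (univ.filter fun x => x ∈ Z) = Z := by ext x; simp
      rw [this, hS, card_image_of_injective _ (iw_bxor_injective xZ), hcardV]; norm_num
    rw [sum_sub_distrib, hind, ← mul_sum] at hsum
    linarith
  -- the partner is not bent: some `wf y₀` is even
  have hpar_f : ∑ y, wf y ^ 2 = 4096 := by
    have h := zms_sum_u_sq 2 f (fun y => 4 * wf y) (fun y => by rw [hwf y]; push_cast; ring)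
    have e4 : ∑ y, (((4 * wf y : ℤ)) : ℝ) ^ 2 = 16 * ∑ y, ((wf y : ℝ)) ^ 2 := by
      rw [mul_sum]; exact sum_congr rfl fun y _ => by push_cast; ring
    rw [e4] at h
    norm_num at h
    have h' : ∑ y, ((wf y : ℝ)) ^ 2 = 4096 := by linarith
    exact_mod_cast h'
  have hnotbent : ∃ y₀, ¬ Odd (wf y₀) := by
    by_contra hall
    push Not at hall
    have hsq1' : ∀ y, wf y ^ 2 = 1 := by
      have hge : ∀ y, (1 : ℤ) ≤ wf y ^ 2 := fun y => by
        have h0' := Int.odd_iff.1 (hall y)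
        have : wf y ≤ -1 ∨ 1 ≤ wf y := by omega
        have := tp_sq_ge (k := 1) (by norm_num) this
        linarith
      have hsum0 : ∑ y, (wf y ^ 2 - 1 : ℤ) = 0 := by
        rw [sum_sub_distrib, hpar_f, sum_const, card_univ, Fintype.card_fun, Fintype.card_bool, Fintype.card_fin]; norm_num
      intro y
      have := (sum_eq_zero_iff_of_nonneg fun z _ => by have := hge z; linarith).1 hsum0 y (mem_univ y)
      linarith
    have hbent : ∀ y, W (fun x => signOf (f x)) y ^ 2 = (2 : ℝ) ^ (6 + 6) := by
      intro y
      rw [hwf y, mul_pow]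
      have : ((wf y : ℝ)) ^ 2 = 1 := by exact_mod_cast hsq1' y
      rw [this]; norm_num
    have hΦ' : forrelation g f = forrelation f g := by
      rw [Summit.QuantumAdvantage.QuantumAdvantage.Theorems.SignedCubicForrelationNotPrBPP.Negative.HalfQuad.forrelation_comm]
    rcases tw_bent_end (by norm_num) g f hg hf hbent with h | h
    · rw [hΦ'] at h; rw [h] at hhi; exact lt_irrefl _ hhi
    · rw [hΦ'] at h; norm_num at h; linarith
  obtain ⟨y₀, hy₀⟩ := hnotbent
  have hE'odd : Odd (wf y₀ - sZ (g y₀)) := by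
    have hev := Int.not_odd_iff_even.1 hy₀
    rcases tp_sZ_cases (g y₀) with hs | hs <;> rw [hs]
    · exact Int.odd_sub.2 (iff_of_false (Int.not_odd_iff_even.2 hev) (by decide))
    · exact Int.odd_sub.2 (iff_of_false (Int.not_odd_iff_even.2 hev) (by decide))
  -- the duality `ê(y₀) = −64 e′(y₀)`
  have hdual := l5k_duality f g (fun x => 2 * u'' x) (fun x => by rw [hu'']; push_cast; ring) (fun y => 2 * wf y)
    (fun y => by rw [hwf]; push_cast; ring) y₀
  beta_reduce at hdual
  have hlhs : ∑ a, (((2 * u'' a - 2 * sZ (f a) : ℤ)) : ℝ) * twist a y₀ = 2 * ∑ a, ((e a : ℤ) : ℝ) * twist a y₀ := by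
    rw [mul_sum]
    refine sum_congr rfl fun x _ => ?_
    simp only [e]; push_cast; ring
  rw [hlhs] at hdual
  have hehat : ∑ a, ((e a : ℤ) : ℝ) * twist a y₀ = -64 * (((wf y₀ - sZ (g y₀) : ℤ)) : ℝ) := by
    have h2 : (2 : ℝ) * ∑ a, ((e a : ℤ) : ℝ) * twist a y₀ = 2 * (-64 * (((wf y₀ - sZ (g y₀) : ℤ)) : ℝ)) := by
      rw [hdual]; push_cast; ring
    linarith
  -- `π̂(y₀) = ê(y₀) − Ŝ(y₀)` is small (`|π̂| ≤ Σ|π| ≤ 63`) but equals `64·(odd)`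
  obtain ⟨m, hm⟩ := h256 y₀
  have hπhat : ∑ a, (((e a - S a : ℤ)) : ℝ) * twist a y₀ = (((-64 * (wf y₀ - sZ (g y₀)) - 256 * m : ℤ)) : ℝ) := by
    have h1 : ∑ a, (((e a - S a : ℤ)) : ℝ) * twist a y₀ =
        ∑ a, ((e a : ℤ) : ℝ) * twist a y₀ - ∑ a, ((S a : ℤ) : ℝ) * twist a y₀ := by
      rw [← sum_sub_distrib]; exact sum_congr rfl fun x _ => by push_cast; ring
    rw [h1, hehat, hShat y₀, hm]; push_cast; ring
  have habs := tzd_abs_charsum_le (fun a => e a - S a) y₀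
  beta_reduce at habs
  rw [hπhat, ← Int.cast_abs] at habs
  have hint : |-64 * (wf y₀ - sZ (g y₀)) - 256 * m| ≤ ∑ x, |e x - S x| := Int.cast_le.1 habs
  have h1 := le_abs_self (-64 * (wf y₀ - sZ (g y₀)) - 256 * m)
  have h2 := neg_abs_le (-64 * (wf y₀ - sZ (g y₀)) - 256 * m)
  have hodd' := Int.odd_iff.1 hE'odd
  omega

end Summit.QuantumAdvantage.QuantumAdvantage.Theorems.CubicForrelation.NearExactIsExact

end
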